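import Literature.NumberTheory.GaloisCohomology.CartierStructure
import Literature.NumberTheory.GaloisCohomology.InverseCartierOperator
import HarnessLib

/-!
# The Cartier isomorphism for a ring with a finite `p`-basis

For a ring `R` of characteristic `p` with a finite `p`-basis `t : ι → R` (`ι` linearly ordered), the inverse
Cartier operator of `InverseCartierOperator.lean`,

  `γ = invCartier p R n : Ωⁿ_R = ⋀ⁿ Ω[R⁄ℤ] →ₗ[R] Hⁿ = Zⁿ/Bⁿ`,  `γ (db₁ ∧ ⋯ ∧ dbₙ) = [b₁^{p-1}db₁ ∧ ⋯ ∧ bₙ^{p-1}dbₙ]`,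

is **bijective** (`IsPBasis.invCartier_bijective`), i.e. an `R`-linear isomorphism onto the Frobenius-twisted
`Hⁿ` (`IsPBasis.cartierEquiv`): on the basis `dt_s` of `Ωⁿ_R` it takes the values `[t_s^{p-1} dt_s]`
(`invCartier_formBasis`), which form the basis `deRhamHBasis` of `Hⁿ` (`CartierStructure.lean`).  This is the
CARTIER ISOMORPHISM `C⁻¹ : Ωⁿ_{R} ≅ Hⁿ(Ω•_R)` (`F`-semilinear) in the generality of rings with a `p`-basis
(polynomial algebras over perfect rings `PBasisMvPolynomial.lean`, their localizations `PBasisLocalization.lean`,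
smooth algebras over perfect fields locally, finitely generated fields over perfect fields) — the analytic input
`F3b` of Gersten purity for `H¹(−, Ωⁿ_log)` (Gros–Suwa) recorded in `KatoCohomologyPurityDeRham.lean`.

## References

* P. Cartier, *Une nouvelle opération sur les formes différentielles*, C. R. Acad. Sci. 244 (1957). [folklore]
* N. Katz, *Nilpotent connections and the monodromy theorem*, Publ. IHÉS 39 (1970), Thm. 7.2. [folklore]
* L. Illusie, *Complexe de de Rham–Witt et cohomologie cristalline*, Ann. Sci. ÉNS 12 (1979), 0.(2.1.9). [Illusie1979]
-/

noncomputable section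

open scoped BigOperators
open KaehlerDifferential (D)
open Literature.AlgebraicGeometry.Crystalline.KaehlerExteriorDerivative (kaehlerExteriorDerivative)

namespace Literature.NumberTheory.GaloisCohomology

universe u v

namespace IsPBasis

open DeRhamWeights

variable {p : ℕ} [hp : Fact p.Prime] {R : Type u} [CommRing R] [CharP R p] {ι : Type v} [Fintype ι]
  [LinearOrder ι] {t : ι → R} (h : IsPBasis p t)

/-! ### `γ` on the basis forms `dt_s` -/

omit hp [CharP R p] [Fintype ι] in
/-- A product over the increasing enumeration of `s` is the product over `s`. [folklore] -/
private theorem prod_comp_ofFinEmbEquiv_symm {n : ℕ} (s : Set.powersetCard ι n) (f : ι → R) :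
    ∏ j : Fin n, f ((Set.powersetCard.ofFinEmbEquiv.symm s) j) = ∏ i ∈ (s : Finset ι), f i := by
  rw [Set.powersetCard.ofFinEmbEquiv_symm_apply]
  have key := Finset.prod_map Finset.univ ((Finset.orderEmbOfFin (s : Finset ι) s.prop).toEmbedding) f
  rw [Finset.map_orderEmbOfFin_univ] at key
  exact key.symm

omit [CharP R p] in
/-- `∏_{i ∈ s} t_i^{p-1} = t^{(p-1)𝟙_s}`. [folklore] -/
theorem prod_pow_pred_eq_pMonomial_cartierExp (s : Finset ι) :
    ∏ i ∈ s, t i ^ (p - 1) = pMonomial p t (cartierExp (p := p) s) := by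
  classical
  unfold pMonomial
  rw [← Finset.prod_filter_mul_prod_filter_not Finset.univ (· ∈ s)]
  rw [Finset.filter_mem_eq_inter, Finset.univ_inter,
    Finset.prod_eq_one (s := Finset.univ.filter (· ∉ s)) fun i hi => by
      rw [cartierExp_of_not_mem (Finset.mem_filter.1 hi).2, Fin.val_zero, pow_zero], mul_one]
  exact Finset.prod_congr rfl fun i hi => by rw [cartierExp_of_mem hi, val_predP]

/-- **`γ (dt_s) = [t_s^{p-1} dt_s]`**: the inverse Cartier operator on the basis forms. [cite: Illusie1979, 0.(2.1.9)] -/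
theorem invCartier_formBasis (n : ℕ) (s : Set.powersetCard ι n) :
    invCartier p R n (h.formBasis n s) = h.deRhamHBasis n s := by
  rw [deRhamHBasis_apply]
  have hL : h.formBasis n s =
      exteriorPower.ιMulti R n (fun j => D ℤ R (t ((Set.powersetCard.ofFinEmbEquiv.symm s) j))) := by
    rw [formBasis_apply]
    rfl
  conv_lhs => rw [hL, invCartier_ιMulti_D]
  refine deRhamH.cls_congr ?_ _ _
  simp only [cartierForm]
  rw [AlternatingMap.map_smul_univ, prod_comp_ofFinEmbEquiv_symm s fun i => t i ^ (p - 1),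
    prod_pow_pred_eq_pMonomial_cartierExp, hL]

/-- `γ (∑ c_s • dt_s) = ∑ c_s • [t_s^{p-1} dt_s]` — `γ` maps the basis `formBasis` to the basis `deRhamHBasis`
coordinatewise (the `•` on `Hⁿ` being the twisted one, `c • [ω] = [c^p ω]`). [folklore] -/
theorem invCartier_eq_sum_repr (n : ℕ) (ω : ⋀[R]^n (Ω[R⁄ℤ])) :
    invCartier p R n ω = ∑ s, (h.formBasis n).repr ω s • h.deRhamHBasis n s := by
  conv_lhs => rw [← (h.formBasis n).sum_repr ω, map_sum]
  exact Finset.sum_congr rfl fun s _ => by rw [map_smul, invCartier_formBasis]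

/-! ### Bijectivity -/

/-- **The inverse Cartier operator is the linear map taking the basis `dt_s` to the basis `[t_s^{p-1} dt_s]`,**
hence an isomorphism: `γ = (deRhamHBasis).constr ∘ …`; concretely `(deRhamHBasis).repr (γ ω) = (formBasis).repr ω`.
[cite: Illusie1979, 0.(2.1.9)] -/
theorem deRhamHBasis_repr_invCartier (n : ℕ) (ω : ⋀[R]^n (Ω[R⁄ℤ])) (s : Set.powersetCard ι n) :
    (h.deRhamHBasis n).repr (invCartier p R n ω) s = (h.formBasis n).repr ω s := by
  rw [h.invCartier_eq_sum_repr n ω, map_sum]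
  simp only [map_smul, Module.Basis.repr_self, Finsupp.smul_single, smul_eq_mul, mul_one,
    Finsupp.finsetSum_apply, Finsupp.single_apply]
  rw [Finset.sum_ite_eq' Finset.univ, if_pos (Finset.mem_univ _)]

include h in
/-- **The Cartier isomorphism, injectivity.** [cite: Illusie1979, 0.(2.1.9)] -/
theorem invCartier_injective (n : ℕ) : Function.Injective (invCartier p R n) := by
  intro ω ω' hω
  apply (h.formBasis n).repr.injective
  ext s
  rw [← h.deRhamHBasis_repr_invCartier n ω s, ← h.deRhamHBasis_repr_invCartier n ω' s, hω]

include h in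
/-- **The Cartier isomorphism, surjectivity**: every class is `γ` of the form with the same coordinates.
[cite: Illusie1979, 0.(2.1.9)] -/
theorem invCartier_surjective (n : ℕ) : Function.Surjective (invCartier p R n) := by
  intro x
  refine ⟨∑ s, (h.deRhamHBasis n).repr x s • h.formBasis n s, ?_⟩
  rw [map_sum]
  conv_rhs => rw [← (h.deRhamHBasis n).sum_repr x]
  exact Finset.sum_congr rfl fun s _ => by rw [map_smul, invCartier_formBasis]

include h in
/-- **THE CARTIER ISOMORPHISM**: for a ring of characteristic `p` with a finite `p`-basis, the inverse Cartier
operator `γ : Ωⁿ_R → Hⁿ(Ω•_R) = Zⁿ/Bⁿ`, `a db₁ ∧ ⋯ ∧ dbₙ ↦ [a^p b₁^{p-1} ⋯ bₙ^{p-1} db₁ ∧ ⋯ ∧ dbₙ]`, is bijective.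
[cite: Illusie1979, 0.(2.1.9)] -/
theorem invCartier_bijective (n : ℕ) : Function.Bijective (invCartier p R n) :=
  ⟨h.invCartier_injective n, h.invCartier_surjective n⟩

/-- **The Cartier isomorphism as a linear equivalence** `Ωⁿ_R ≃ₗ[R] Hⁿ` (the target twisted by Frobenius).
[cite: Illusie1979, 0.(2.1.9)] -/
def cartierEquiv (n : ℕ) : ⋀[R]^n (Ω[R⁄ℤ]) ≃ₗ[R] deRhamH p R n :=
  LinearEquiv.ofBijective (invCartier p R n) (h.invCartier_bijective n)

/-- `cartierEquiv` is `invCartier`. [folklore] -/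
@[simp] theorem cartierEquiv_apply (n : ℕ) (ω : ⋀[R]^n (Ω[R⁄ℤ])) : h.cartierEquiv n ω = invCartier p R n ω :=
  rfl

/-! ### Consequences for closed forms -/

/-- **Every closed `n`-form is `∑ c_s^p t_s^{p-1} dt_s` plus an exact form** (coordinates `c_s` in `R`): the
image of `γ` exhausts `Hⁿ`. [cite: Illusie1979, 0.(2.1.9)] -/
theorem exists_sub_sum_mem_exactForms_of_closed (n : ℕ) (ω : ⋀[R]^n (Ω[R⁄ℤ]))
    (hω : kaehlerExteriorDerivative ℤ R n ω = 0) :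
    ∃ c : Set.powersetCard ι n → R,
      ω - ∑ s, (c s ^ p * pMonomial p t (cartierExp (s : Finset ι))) • h.formBasis n s ∈ exactForms R n := by
  have hcl : FrobeniusTwist.of p R ω ∈ closedTwist p R n := hω
  let y : LinearMap.range (h.πTwist n) := ⟨h.πTwist n (FrobeniusTwist.of p R ω), LinearMap.mem_range_self _ _⟩
  refine ⟨fun s => (h.cartierVecBasis n).repr y s, ?_⟩
  have hy : h.πTwist n (FrobeniusTwist.of p R ω) = ∑ s, (h.cartierVecBasis n).repr y s • h.cartierVec n s := by
    have e := congrArg (fun z : LinearMap.range (h.πTwist n) => (z : FrobeniusTwist p R (⋀[R]^n (Ω[R⁄ℤ]))))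
      ((h.cartierVecBasis n).sum_repr y)
    simp only [Submodule.coe_sum, Submodule.coe_smul_of_tower, coe_cartierVecBasis_apply] at e
    exact e.symm
  have hsum : ∑ s, (h.cartierVecBasis n).repr y s • h.cartierVec n s =
      FrobeniusTwist.of p R (∑ s, (((h.cartierVecBasis n).repr y s) ^ p *
        pMonomial p t (cartierExp (s : Finset ι))) • h.formBasis n s) := by
    rw [map_sum]
    exact Finset.sum_congr rfl fun s _ => by rw [cartierVec_eq, FrobeniusTwist.smul_of, smul_smul]
  have key := h.sub_πTwist_mem_exactTwist n hcl
  rw [hy, hsum, ← map_sub, mem_exactTwist_iff, AddEquiv.symm_apply_apply] at key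
  exact key

end IsPBasis

end Literature.NumberTheory.GaloisCohomology

end
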